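import Literature.AlgebraicGeometry.HodgeTheory.GeneralHodgePropertyKnownCases
import Literature.AlgebraicGeometry.HodgeTheory.MonodromySemisimpleSubvariations
import HarnessLib

/-!
# Hard Lefschetz halves the window of the amended general Hodge conjecture:
# `Lʲ_η : max(k, r) ≅ max(k + 2j, r + j)` for `k + j = dim X`, hence `GHC(X, k, r) ⟹ GHC(X, k + 2j, r + j)`

Family `hodge`, layer `Literature/AlgebraicGeometry/HodgeTheory`; lane `lit-hodgefound` (Track 2 foundations,
Layer A1/A4). THEOREMS ONLY (no definition, no named fact; D-0026).

Source, verbatim (C. Voisin, *Hodge and generalized Hodge conjectures, coniveau and algebraic cycles*, J. Open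
Math. Probl. 1 (2025), §4.3, first paragraph, p. 40): «Let `L ⊂ Hᵏ(X, ℚ)` and `c` be its coniveau. In order to
solve the generalized Hodge conjecture for `L`, we can assume that `k ≤ n = dim X`, by the hard Lefschetz
isomorphism. Indeed, if `k = n + r`, with `r > 0`, then we have the Lefschetz isomorphism
`lʳ : H^{n−r}(X, ℚ) → H^{n+r}(X, ℚ)` determined by an ample class `l = c₁(L)`. This isomorphism of Hodge
structures provides a Hodge substructure `L′ ⊂ H^{n−r}(X, ℚ)` which is isomorphic to `L`, and has coniveau
`c − r`. If we solve the generalized Hodge conjecture for `L′`, then `L′` is supported on a subvariety of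
codimension `≥ c − r` so `L = lʳ ⌣ L′` is supported on a subvariety of codimension `≥ c`.»

On the tree's carriers (`GHC(X, i, r) = GeneralHodgePropertyFor n X i r`, admissible subspaces
`HodgeModel.ratSubHodgeInFilt`, their supremum `HodgeModel.maxRatSubHodgeInFilt`; `η = D.Hη` the rational
Kähler class of a Kähler–rational datum `D`, `Lʲ_η = lefschetzPow D.Hη j k : Hᵏ → H^{k+2j}`, bijective for
`k + j = n` by `KaehlerRationalDatum.hasHardLefschetzProperty` and `…hasHardLefschetzProperty_rat` over `ℚ`):

* §1 SUB-HODGE ⟺ STABLE UNDER THE TYPE PROJECTORS: `HodgeModel.IsSubHodge.typeProj_mem`,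
  `HodgeModel.isSubHodge_map_of_forall_typeProj_mem`, **`HodgeModel.isSubHodge_map_iff_forall_typeProj_mem`**
  (Voisin I §7.3.1: a sub-Hodge structure is «stable under decomposition into `p, q` types», Grothendieck
  p. 300); hence the BRIDGE **`HodgeModel.isSubHodge_map_iff_isHodgeSubspace`** between the barrier
  catalogue's `HodgeModel.IsSubHodge` (`Barriers/HodgeConjecture/GeneralizedHodgeTrivialReasonsSubHodge`) and the
  model-free `IsHodgeSubspace` of `MonodromySemisimpleSubvariations` (Deligne 1987 §1.1, via its
  `isHodgeSubspace_iff_typeProj_mem`) — the two notions of the tree agree; and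
  `HodgeModel.mem_hodgeFiltrationBetti_of_typeProj_eq_zero`.
* §2 **`KaehlerRationalDatum.lefschetzPow_typeProj`** — `Lʲ_η ∘ π_{(p,q)} = π_{(p+j,q+j)} ∘ Lʲ_η` (`L` has
  bidegree `(1, 1)`, Voisin I Rem. 6.27; the tree's `HodgeModel.lefschetzOperator_typeProj`, iterated through
  `KaehlerRationalDatum.lefschetzPow_mem_typePiece`).
* §3 THE PREIMAGE `(Lʲ_η)⁻¹ W'` OF AN ADMISSIBLE `W' ⊆ F^{r+j} H^{k+2j}` IS ADMISSIBLE IN `(Hᵏ, Fʳ)` for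
  `k + j = n` («provides a Hodge substructure `L′ ⊂ H^{n−r}(X, ℚ)` … isomorphic to `L`, … coniveau `c − r`»):
  `KaehlerRationalDatum.isRationallySpanned_comap_lefschetzPow` (rational hard Lefschetz),
  `…isSubHodge_comap_lefschetzPow` (§1–§2), `…comap_lefschetzPow_le_hodgeFiltrationBetti`,
  **`…comap_lefschetzPow_mem_ratSubHodgeInFilt`**.
* §4 **`KaehlerRationalDatum.map_lefschetzPow_maxRatSubHodgeInFilt_eq`** — `Lʲ_η(max(k, r)) = max(k + 2j, r + j)`
  for `k + j = n` (the `≤` half is the tree's `…map_lefschetzPow_maxRatSubHodgeInFilt_le`, any `k`, `j`);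
  `…comap_lefschetzPow_maxRatSubHodgeInFilt_eq`; `finrank_maxRatSubHodgeInFilt_eq_of_add_eq_dim`.
* §5 **`generalHodgePropertyFor_of_add_eq_dim`** — `GHC(X, k, r) ⟹ GHC(X, k + 2j, r + j)` for `k + j = n`
  (the printed reduction: `max(k + 2j, r + j) = Lʲ_η max(k, r) ≤ Lʲ_η Nʳ Hᵏ ⊆ N^{r+j} H^{k+2j}`, the last step
  by the tree's `map_lefschetzPow_supportedClasses_le`); **`forall_generalHodgePropertyFor_iff_lower_window`**
  (`GHC(X)` in all degrees ⟺ in the LOWER window `1 ≤ r`, `2r ≤ i ≤ dim X`, `i < dim X + r`, refining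
  `forall_generalHodgePropertyFor_iff_window`); **`forall_generalHodgePropertyFor_dim_four_iff`** (fourfolds:
  `⟺ GHC(X, 3, 1) ∧ GHC(X, 4, 1) ∧ GHC(X, 4, 2)`, the last being the Hodge conjecture in codimension `2`,
  `generalHodgePropertyFor_two_mul_self_iff`).

## References

* [Voisin2025] C. Voisin, Hodge and generalized Hodge conjectures, coniveau and algebraic cycles, J. Open Math.
  Probl. 1 (2025), §4.3 (first paragraph, p. 40), §2.3, Def. 2.8.
* [VoisinHodgeI2002] C. Voisin, Hodge Theory and Complex Algebraic Geometry I, CUP 2002, §6.2.3 Thm. 6.25 and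
  Rem. 6.27, §7.1.1–7.1.2, §7.3.1, §11.3 Conj. 11.37.
* [GrothendieckTopology1969] A. Grothendieck, Hodge's general conjecture is false for trivial reasons, Topology
  8 (1969), p. 300.
* [MurreTorino1994] J. P. Murre, Algebraic cycles and algebraic aspects of cohomology and K-theory (Torino
  1993), LNM 1594, §5.6–§5.8.
* [Deligne1987] P. Deligne, Un théorème de finitude pour la monodromie, Progr. Math. 67 (1987), §1.1.
-/

noncomputable section

open CategoryTheory AlgebraicGeometry Module
open Literature.AlgebraicTopology.SingularHomology
open Literature.Geometry.Kaehler
open Literature.AlgebraicGeometry.Motives (IsSmoothProjective ComplexPoints)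

namespace Literature.AlgebraicGeometry.HodgeTheory

variable {n : ℕ} {X : Motives.SchemeOver ℂ}

/-! ### §1 Sub-Hodge structures are the subspaces stable under the type projectors -/

/-- **A sub-Hodge structure contains the type components of its elements**: if the pull-back of
`W ⊆ Hᵏ(X(ℂ); ℂ)` to the Hodge model `A` is a sub-Hodge structure, then `π_{(p,q)} c ∈ W` for every
`c ∈ W` («stable under decomposition into `p, q` types»; uniqueness of the type decomposition).
[cite: GrothendieckTopology1969, p. 300] [cite: VoisinHodgeI2002, §7.3.1 and Thm. 6.18] -/
theorem HodgeModel.IsSubHodge.typeProj_mem (A : HodgeModel n X) {k : ℕ}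
    {W : Submodule ℂ (complexBetti X k)} (hW : A.IsSubHodge k (W.map (A.pullback k).hom))
    {c : complexBetti X k} (hc : c ∈ W) (pq : ↥(Finset.HasAntidiagonal.antidiagonal k)) :
    A.typeProj k pq c ∈ W := by
  -- the classes all of whose type components lie in `W`
  let S : Submodule ℂ (complexBetti X k) :=
    ⨅ i : ↥(Finset.HasAntidiagonal.antidiagonal k), W.comap (A.typeProj k i)
  suffices h : c ∈ S from Submodule.mem_comap.1 ((Submodule.mem_iInf _).1 h pq)
  have hle : (⨆ (p : ℕ) (q : ℕ) (_ : p + q = k), W.map (A.pullback k).hom ⊓ A.hodgePQ k p q) ≤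
      S.map (A.pullback k).hom := by
    refine iSup_le fun p ↦ iSup_le fun q ↦ iSup_le fun hpq ↦ ?_
    rintro z ⟨⟨w, hw, rfl⟩, hz⟩
    refine ⟨w, (Submodule.mem_iInf _).2 fun i ↦ Submodule.mem_comap.2 ?_, rfl⟩
    have hwt : w ∈ A.typePiece k ⟨(p, q), Finset.HasAntidiagonal.mem_antidiagonal.2 hpq⟩ :=
      (A.mem_typePiece_iff _ _).2 hz
    by_cases hi : (⟨(p, q), Finset.HasAntidiagonal.mem_antidiagonal.2 hpq⟩ :
        ↥(Finset.HasAntidiagonal.antidiagonal k)) = i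
    · subst hi
      rw [A.typeProj_apply_of_mem hwt]
      exact hw
    · rw [A.typeProj_apply_of_mem_ne hi hwt]
      exact W.zero_mem
  obtain ⟨c', hc', hcc'⟩ := hle (hW.le (Submodule.mem_map_of_mem hc))
  obtain rfl : c' = c := A.pullback_injective k hcc'
  exact hc'

/-- **A subspace stable under the type projectors pulls back to a sub-Hodge structure**: if
`π_{(p,q)} c ∈ W` for all `c ∈ W` and all `(p, q)`, then `A^* W = ⊕ (A^* W ∩ H^{p,q})`
(`A^* c = Σ A^*(π_{(p,q)} c)`). [cite: VoisinHodgeI2002, §7.3.1 and Thm. 6.18] -/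
theorem HodgeModel.isSubHodge_map_of_forall_typeProj_mem (A : HodgeModel n X) {k : ℕ}
    {W : Submodule ℂ (complexBetti X k)}
    (h : ∀ c ∈ W, ∀ pq : ↥(Finset.HasAntidiagonal.antidiagonal k), A.typeProj k pq c ∈ W) :
    A.IsSubHodge k (W.map (A.pullback k).hom) := by
  refine (A.isSubHodge_iff_le k _).2 ?_
  rintro _ ⟨c, hc, rfl⟩
  rw [← A.sum_typeProj k c, map_sum]
  refine Submodule.sum_mem _ fun pq _ ↦ ?_
  exact Submodule.mem_iSup_of_mem pq.1.1 (Submodule.mem_iSup_of_mem pq.1.2 (Submodule.mem_iSup_of_mem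
    (Finset.HasAntidiagonal.mem_antidiagonal.1 pq.2)
    ⟨Submodule.mem_map_of_mem (h c hc pq), (A.mem_typePiece_iff pq _).1 (A.typeProj_mem k pq c)⟩))

/-- **`A^* W` is a sub-Hodge structure iff `W` is stable under all type projectors `π_{(p,q)}`.**
[cite: GrothendieckTopology1969, p. 300] [cite: VoisinHodgeI2002, §7.3.1] -/
theorem HodgeModel.isSubHodge_map_iff_forall_typeProj_mem (A : HodgeModel n X) {k : ℕ}
    (W : Submodule ℂ (complexBetti X k)) :
    A.IsSubHodge k (W.map (A.pullback k).hom) ↔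
      ∀ c ∈ W, ∀ pq : ↥(Finset.HasAntidiagonal.antidiagonal k), A.typeProj k pq c ∈ W :=
  ⟨fun hW _ hc pq ↦ hW.typeProj_mem A hc pq, A.isSubHodge_map_of_forall_typeProj_mem⟩

/-- **The two sub-Hodge notions of the tree agree**: for a subspace `W ⊆ Hᵏ(X(ℂ); ℂ)` of a smooth
projective `X` and any Hodge model `A`, the pull-back `A^* W` is a sub-Hodge structure in the sense of the
barrier catalogue (`HodgeModel.IsSubHodge`: `A^* W = ⊕ (A^* W ∩ H^{p,q})`) iff `W` is a Hodge subspace in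
the model-free sense of `MonodromySemisimpleSubvariations` (`IsHodgeSubspace`: every element is a sum of
elements of `W` of pure type) — both say «stable under the type projectors» (§1 and the tree's
`isHodgeSubspace_iff_typeProj_mem`). [cite: VoisinHodgeI2002, §7.3.1] [cite: Deligne1987, §1.1]
[cite: GrothendieckTopology1969, p. 300] -/
theorem HodgeModel.isSubHodge_map_iff_isHodgeSubspace (hX : IsSmoothProjective n X) (A : HodgeModel n X)
    {k : ℕ} (W : Submodule ℂ (complexBetti X k)) :
    A.IsSubHodge k (W.map (A.pullback k).hom) ↔ IsHodgeSubspace n X k W :=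
  (A.isSubHodge_map_iff_forall_typeProj_mem W).trans (isHodgeSubspace_iff_typeProj_mem hX A W).symm

/-- **A class all of whose type components with `p < r` vanish lies in `Fʳ Hᵏ`** (`A^* c = Σ_{p ≥ r} A^*(π_{(p,q)} c)`
and `H^{p,q} ⊆ Fʳ` for `p ≥ r`); converse of the tree's `HodgeModel.typeProj_eq_zero_of_mem_hodgeFiltration`.
[cite: VoisinHodgeI2002, §7.1.1] -/
theorem HodgeModel.mem_hodgeFiltrationBetti_of_typeProj_eq_zero (A : HodgeModel n X) {k r : ℕ}
    {c : complexBetti X k}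
    (h : ∀ pq : ↥(Finset.HasAntidiagonal.antidiagonal k), pq.1.1 < r → A.typeProj k pq c = 0) :
    c ∈ A.hodgeFiltrationBetti k r := by
  rw [HodgeModel.mem_hodgeFiltrationBetti, ← A.sum_typeProj k c, map_sum]
  refine Submodule.sum_mem _ fun pq _ ↦ ?_
  by_cases hp : pq.1.1 < r
  · rw [h pq hp, map_zero]
    exact Submodule.zero_mem _
  · exact A.hodgePQ_le_hodgeFiltration (Finset.HasAntidiagonal.mem_antidiagonal.1 pq.2) (not_lt.1 hp)
      ((A.mem_typePiece_iff pq _).1 (A.typeProj_mem k pq c))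

/-! ### §2 `Lʲ_η` commutes with the type projectors up to the shift `(p, q) ↦ (p + j, q + j)` -/

namespace KaehlerRationalDatum

variable (D : KaehlerRationalDatum n X)

/-- `Lʲ_η c` is of Hodge type `(p + j, q + j)` for `c` of type `(p, q)` (the tree's
`isOfHodgeType_lefschetzPowTo'` in the `lefschetzPow` spelling). [cite: VoisinHodgeI2002, §6.2.3 Rem. 6.27 and §7.1.2] -/
theorem isOfHodgeType_lefschetzPow_of_add_eq (hX : IsSmoothProjective n X) {k p q p' q' : ℕ} (j : ℕ)
    (hp : p + j = p') (hq : q + j = q') {c : complexBetti X k} (hc : IsOfHodgeType n X k p q c) :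
    IsOfHodgeType n X (k + 2 * j) p' q' (lefschetzPow D.Hη j k c) := by
  rw [← lefschetzPowTo_eq_lefschetzPow]
  exact D.isOfHodgeType_lefschetzPowTo' hX rfl hp hq hc

/-- **`Lʲ_η` maps the type piece `(p, q)` of `Hᵏ` into the type piece `(p + j, q + j)` of `H^{k+2j}`.**
[cite: VoisinHodgeI2002, §6.2.3 Rem. 6.27 and §7.1.2] -/
theorem lefschetzPow_mem_typePiece (hX : IsSmoothProjective n X) (A : HodgeModel n X) {k : ℕ} (j : ℕ)
    (pq : ↥(Finset.HasAntidiagonal.antidiagonal k)) (pq' : ↥(Finset.HasAntidiagonal.antidiagonal (k + 2 * j)))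
    (hpq' : pq'.1 = (pq.1.1 + j, pq.1.2 + j)) {c : complexBetti X k} (hc : c ∈ A.typePiece k pq) :
    lefschetzPow D.Hη j k c ∈ A.typePiece (k + 2 * j) pq' := by
  rw [A.mem_typePiece_iff_isOfHodgeType' hX] at hc ⊢
  have h1 : pq'.1.1 = pq.1.1 + j := by rw [hpq']
  have h2 : pq'.1.2 = pq.1.2 + j := by rw [hpq']
  rw [h1, h2]
  exact D.isOfHodgeType_lefschetzPow_of_add_eq hX j rfl rfl hc

/-- **`Lʲ_η ∘ π_{(p,q)} = π_{(p+j,q+j)} ∘ Lʲ_η`**: the iterated Lefschetz operator of the rational Kähler class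
commutes with the type projectors up to the shift of types by `(j, j)` («`L` is of bidegree `(1, 1)` for the
bigraduation given by the Hodge decomposition», and uniqueness of the type decomposition of `Lʲ_η c`).
[cite: VoisinHodgeI2002, §6.2.3 Rem. 6.27 and §7.1.2] [cite: Voisin2025, §2.3] -/
theorem lefschetzPow_typeProj (hX : IsSmoothProjective n X) (A : HodgeModel n X) {k : ℕ} (j : ℕ)
    (pq : ↥(Finset.HasAntidiagonal.antidiagonal k)) (c : complexBetti X k)
    (pq' : ↥(Finset.HasAntidiagonal.antidiagonal (k + 2 * j))) (hpq' : pq'.1 = (pq.1.1 + j, pq.1.2 + j)) :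
    lefschetzPow D.Hη j k (A.typeProj k pq c) = A.typeProj (k + 2 * j) pq' (lefschetzPow D.Hη j k c) := by
  classical
  -- the shift of the antidiagonal by `(j, j)`
  let σ : ↥(Finset.HasAntidiagonal.antidiagonal k) → ↥(Finset.HasAntidiagonal.antidiagonal (k + 2 * j)) :=
    fun i ↦ ⟨(i.1.1 + j, i.1.2 + j), Finset.HasAntidiagonal.mem_antidiagonal.2 (by
      have := Finset.HasAntidiagonal.mem_antidiagonal.1 i.2; omega)⟩
  have hσ : Function.Injective σ := by
    intro a b hab
    have h := congrArg Subtype.val hab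
    simp only [σ, Prod.mk.injEq] at h
    exact Subtype.ext (Prod.ext (by omega) (by omega))
  have hpq'σ : pq' = σ pq := Subtype.ext hpq'
  -- the decomposition of `Lʲ c` along the shifted types
  let y : ↥(Finset.HasAntidiagonal.antidiagonal (k + 2 * j)) → complexBetti X (k + 2 * j) := fun i' ↦
    ∑ i ∈ Finset.univ.filter (fun i ↦ σ i = i'), lefschetzPow D.Hη j k (A.typeProj k i c)
  have hy : ∀ i', y i' ∈ A.typePiece (k + 2 * j) i' := by
    intro i'
    refine Submodule.sum_mem _ fun i hi ↦ ?_
    rw [Finset.mem_filter] at hi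
    rw [← hi.2]
    exact D.lefschetzPow_mem_typePiece hX A j i (σ i) rfl (A.typeProj_mem k i c)
  have hsum : ∑ i', y i' = lefschetzPow D.Hη j k c := by
    rw [Finset.sum_fiberwise Finset.univ σ (fun i ↦ lefschetzPow D.Hη j k (A.typeProj k i c)), ← map_sum,
      A.sum_typeProj]
  rw [A.typeProj_eq_of_sum_eq hy hsum pq', hpq'σ]
  change _ = ∑ i ∈ Finset.univ.filter (fun i ↦ σ i = σ pq), lefschetzPow D.Hη j k (A.typeProj k i c)
  rw [Finset.sum_eq_single pq]
  · intro i hi hipq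
    rw [Finset.mem_filter] at hi
    exact absurd (hσ hi.2) hipq
  · intro h
    exact absurd (Finset.mem_filter.2 ⟨Finset.mem_univ pq, rfl⟩ :
      pq ∈ Finset.univ.filter (fun i ↦ σ i = σ pq)) h

/-! ### §3 For `k + j = dim X` the preimage of an admissible subspace under `Lʲ_η` is admissible -/

/-- **Rational hard Lefschetz for rationally spanned subspaces**: for `k + j = n`, the preimage under the
(bijective) `Lʲ_η : Hᵏ → H^{k+2j}` of a rationally spanned `W'` is rationally spanned — a rational class of
`W'` is `Lʲ_η` of a RATIONAL class (`hasHardLefschetzProperty_rat`: `Lʲ_η` is bijective on `H(X(ℂ); ℚ)`), and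
`Lʲ_η` is injective. [cite: VoisinHodgeI2002, §6.2.3 Thm. 6.25] [cite: Voisin2025, §4.3 (first paragraph)] -/
theorem isRationallySpanned_comap_lefschetzPow (hX : IsSmoothProjective n X) {k j : ℕ} (hkj : k + j = n)
    {W' : Submodule ℂ (complexBetti X (k + 2 * j))} (hW' : IsRationallySpanned W') :
    IsRationallySpanned (W'.comap (lefschetzPow D.Hη j k)) := by
  have hinj := (D.hasHardLefschetzProperty hX j k hkj).1
  refine (isRationallySpanned_iff_le _).2 fun x hx ↦ ?_
  have hle : Submodule.span ℂ {c' : complexBetti X (k + 2 * j) | c' ∈ W' ∧ IsRationalClass c'} ≤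
      (Submodule.span ℂ {c : complexBetti X k | c ∈ W'.comap (lefschetzPow D.Hη j k) ∧
        IsRationalClass c}).map (lefschetzPow D.Hη j k) := by
    refine Submodule.span_le.2 ?_
    rintro c' ⟨hc'W, hc'⟩
    obtain ⟨v', rfl⟩ := (isRationalClass_iff_mem_range_ofRatClass _).1 hc'
    obtain ⟨v, rfl⟩ := (D.hasHardLefschetzProperty_rat hX j k hkj).2 v'
    rw [D.ofRatClass_lefschetzPow] at hc'W ⊢
    exact ⟨ofRatClass _ k v, Submodule.subset_span ⟨Submodule.mem_comap.2 hc'W, isRationalClass_ofRatClass v⟩,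
      rfl⟩
  obtain ⟨y, hy, hyx⟩ := hle (hW'.le (Submodule.mem_comap.1 hx))
  obtain rfl : y = x := hinj hyx
  exact hy

/-- **The preimage under `Lʲ_η` of a sub-Hodge structure is a sub-Hodge structure** (`k + j = n`): for
`x ∈ (Lʲ_η)⁻¹ W'`, `Lʲ_η(π_{(p,q)} x) = π_{(p+j,q+j)}(Lʲ_η x) ∈ W'` (§2 and §1), so `π_{(p,q)} x ∈ (Lʲ_η)⁻¹ W'`.
[cite: VoisinHodgeI2002, §6.2.3 Thm. 6.25, Rem. 6.27 and §7.3.1] [cite: Voisin2025, §4.3 (first paragraph)] -/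
theorem isSubHodge_comap_lefschetzPow (hX : IsSmoothProjective n X) (B : HodgeModel n X) {k : ℕ} (j : ℕ)
    {W' : Submodule ℂ (complexBetti X (k + 2 * j))}
    (hW' : B.IsSubHodge (k + 2 * j) (W'.map (B.pullback (k + 2 * j)).hom)) :
    B.IsSubHodge k ((W'.comap (lefschetzPow D.Hη j k)).map (B.pullback k).hom) := by
  refine B.isSubHodge_map_of_forall_typeProj_mem fun c hc pq ↦ Submodule.mem_comap.2 ?_
  rw [D.lefschetzPow_typeProj hX B j pq c ⟨(pq.1.1 + j, pq.1.2 + j),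
    Finset.HasAntidiagonal.mem_antidiagonal.2 (by
      have := Finset.HasAntidiagonal.mem_antidiagonal.1 pq.2; omega)⟩ rfl]
  exact hW'.typeProj_mem B (Submodule.mem_comap.1 hc) _

/-- **`(Lʲ_η)⁻¹ F^{r+j} H^{k+2j} ⊆ Fʳ Hᵏ` on subspaces, `k + j = n`**: if `W' ⊆ F^{r+j}` then
`(Lʲ_η)⁻¹ W' ⊆ Fʳ` — a component `π_{(p,q)} x` with `p < r` has `Lʲ_η(π_{(p,q)} x) = π_{(p+j,q+j)}(Lʲ_η x) = 0`
(`Lʲ_η x ∈ F^{r+j}`, `p + j < r + j`), hence vanishes (`Lʲ_η` injective). [cite: VoisinHodgeI2002, §6.2.3 Thm. 6.25 and §7.1.1]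
[cite: Voisin2025, §4.3 (first paragraph)] -/
theorem comap_lefschetzPow_le_hodgeFiltrationBetti (hX : IsSmoothProjective n X) (B : HodgeModel n X)
    {k j : ℕ} (hkj : k + j = n) {r : ℕ} {W' : Submodule ℂ (complexBetti X (k + 2 * j))}
    (hF : W' ≤ B.hodgeFiltrationBetti (k + 2 * j) (r + j)) :
    W'.comap (lefschetzPow D.Hη j k) ≤ B.hodgeFiltrationBetti k r := by
  have hinj := (D.hasHardLefschetzProperty hX j k hkj).1
  intro x hx
  refine B.mem_hodgeFiltrationBetti_of_typeProj_eq_zero fun pq hp ↦ hinj ?_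
  rw [map_zero, D.lefschetzPow_typeProj hX B j pq x ⟨(pq.1.1 + j, pq.1.2 + j),
    Finset.HasAntidiagonal.mem_antidiagonal.2 (by
      have := Finset.HasAntidiagonal.mem_antidiagonal.1 pq.2; omega)⟩ rfl]
  exact B.typeProj_eq_zero_of_mem_hodgeFiltration
    (B.mem_hodgeFiltrationBetti.1 (hF (Submodule.mem_comap.1 hx))) _ (show pq.1.1 + j < r + j by omega)

/-- **THE PREIMAGE OF AN ADMISSIBLE SUBSPACE UNDER THE HARD LEFSCHETZ ISOMORPHISM IS ADMISSIBLE**: for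
`k + j = n` and `W' ∈ B.ratSubHodgeInFilt (k + 2j) (r + j)`, `(Lʲ_η)⁻¹ W' ∈ B.ratSubHodgeInFilt k r` («This
isomorphism of Hodge structures provides a Hodge substructure `L′ ⊂ H^{n−r}(X, ℚ)` which is isomorphic to
`L`, and has coniveau `c − r`»). [cite: Voisin2025, §4.3 (first paragraph)]
[cite: VoisinHodgeI2002, §6.2.3 Thm. 6.25 and §7.3.1] -/
theorem comap_lefschetzPow_mem_ratSubHodgeInFilt (hX : IsSmoothProjective n X) (B : HodgeModel n X)
    {k j : ℕ} (hkj : k + j = n) {r : ℕ} {W' : Submodule ℂ (complexBetti X (k + 2 * j))}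
    (hW' : W' ∈ B.ratSubHodgeInFilt (k + 2 * j) (r + j)) :
    W'.comap (lefschetzPow D.Hη j k) ∈ B.ratSubHodgeInFilt k r :=
  ⟨D.isRationallySpanned_comap_lefschetzPow hX hkj hW'.1, D.isSubHodge_comap_lefschetzPow hX B j hW'.2.1,
    D.comap_lefschetzPow_le_hodgeFiltrationBetti hX B hkj hW'.2.2⟩

/-! ### §4 `Lʲ_η : max(k, r) ≅ max(k + 2j, r + j)` for `k + j = dim X` -/

/-- **HARD LEFSCHETZ FOR GROTHENDIECK'S LARGEST RATIONAL SUB-HODGE STRUCTURES**: for `k + j = n`,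
`Lʲ_η(max(k, r)) = max(k + 2j, r + j)` — `≤` for any `k`, `j` (`Lʲ_η` preserves admissibility, the tree's
`map_lefschetzPow_maxRatSubHodgeInFilt_le`); `≥` because `Lʲ_η` is surjective and the preimage of
`max(k + 2j, r + j)` is admissible (§3), hence inside `max(k, r)`. [cite: Voisin2025, §4.3 (first paragraph)]
[cite: VoisinHodgeI2002, §6.2.3 Thm. 6.25] [cite: GrothendieckTopology1969, p. 300] -/
theorem map_lefschetzPow_maxRatSubHodgeInFilt_eq (hX : IsSmoothProjective n X) (B : HodgeModel n X)
    {k j : ℕ} (hkj : k + j = n) (r : ℕ) :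
    (B.maxRatSubHodgeInFilt k r).map (lefschetzPow D.Hη j k) = B.maxRatSubHodgeInFilt (k + 2 * j) (r + j) := by
  refine le_antisymm (D.map_lefschetzPow_maxRatSubHodgeInFilt_le B hX k r j) fun y hy ↦ ?_
  obtain ⟨x, rfl⟩ := (D.hasHardLefschetzProperty hX j k hkj).2 y
  exact ⟨x, B.le_maxRatSubHodgeInFilt
    (D.comap_lefschetzPow_mem_ratSubHodgeInFilt hX B hkj (B.maxRatSubHodgeInFilt_mem _ _))
      (Submodule.mem_comap.2 hy), rfl⟩

/-- **`(Lʲ_η)⁻¹(max(k + 2j, r + j)) = max(k, r)`** for `k + j = n`. [cite: Voisin2025, §4.3 (first paragraph)]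
[cite: VoisinHodgeI2002, §6.2.3 Thm. 6.25] -/
theorem comap_lefschetzPow_maxRatSubHodgeInFilt_eq (hX : IsSmoothProjective n X) (B : HodgeModel n X)
    {k j : ℕ} (hkj : k + j = n) (r : ℕ) :
    (B.maxRatSubHodgeInFilt (k + 2 * j) (r + j)).comap (lefschetzPow D.Hη j k) = B.maxRatSubHodgeInFilt k r := by
  refine le_antisymm (B.le_maxRatSubHodgeInFilt
    (D.comap_lefschetzPow_mem_ratSubHodgeInFilt hX B hkj (B.maxRatSubHodgeInFilt_mem _ _))) ?_
  rw [← Submodule.map_le_iff_le_comap]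
  exact D.map_lefschetzPow_maxRatSubHodgeInFilt_le B hX k r j

end KaehlerRationalDatum

/-- **`dim max(k, r) = dim max(k + 2j, r + j)` for `k + j = dim X`** (the hard Lefschetz isomorphism of §4).
[cite: Voisin2025, §4.3 (first paragraph)] [cite: VoisinHodgeI2002, §6.2.3 Thm. 6.25] -/
theorem finrank_maxRatSubHodgeInFilt_eq_of_add_eq_dim (hX : IsSmoothProjective n X) (B : HodgeModel n X)
    {k j : ℕ} (hkj : k + j = n) (r : ℕ) :
    finrank ℂ (B.maxRatSubHodgeInFilt k r) = finrank ℂ (B.maxRatSubHodgeInFilt (k + 2 * j) (r + j)) := by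
  obtain ⟨D⟩ := nonempty_kaehlerRationalDatum hX
  rw [← D.map_lefschetzPow_maxRatSubHodgeInFilt_eq hX B hkj r]
  exact (Submodule.equivMapOfInjective _ (D.hasHardLefschetzProperty hX j k hkj).1 _).finrank_eq

/-! ### §5 `GHC(X, k, r) ⟹ GHC(X, k + 2j, r + j)`; the lower window -/

/-- **VOISIN 2025, §4.3: «we can assume that `k ≤ n = dim X`, by the hard Lefschetz isomorphism»** — for
`k + j = n`, `GHC(X, k, r) ⟹ GHC(X, k + 2j, r + j)`: `max(k + 2j, r + j) = Lʲ_η max(k, r)` (§4),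
`max(k, r) ≤ Nʳ Hᵏ` by `GHC(X, k, r)`, and `Lʲ_η Nʳ Hᵏ ⊆ N^{r+j} H^{k+2j}` («`L = lʳ ⌣ L′` is supported on a
subvariety of codimension `≥ c`»; the tree's `map_lefschetzPow_supportedClasses_le`, `η` a divisor class).
[cite: Voisin2025, §4.3 (first paragraph)] [cite: VoisinHodgeI2002, §6.2.3 Thm. 6.25 and §11.3 Conj. 11.37]
[cite: GrothendieckTopology1969, p. 300] -/
theorem generalHodgePropertyFor_of_add_eq_dim (hX : IsSmoothProjective n X) {k j : ℕ} (hkj : k + j = n)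
    {r : ℕ} (h : GeneralHodgePropertyFor n X k r) : GeneralHodgePropertyFor n X (k + 2 * j) (r + j) := by
  obtain ⟨B⟩ := h.1
  obtain ⟨D⟩ := nonempty_kaehlerRationalDatum hX
  refine (generalHodgePropertyFor_iff_of_hodgeModel B hX _ _).2 ?_
  rw [← D.map_lefschetzPow_maxRatSubHodgeInFilt_eq hX B hkj r]
  exact (Submodule.map_mono ((generalHodgePropertyFor_iff_of_hodgeModel B hX k r).1 h)).trans
    (map_lefschetzPow_supportedClasses_le hX (D.ofRatClass_eta_mem_algebraicClasses hX) k r j)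

/-- **The amended general Hodge conjecture for `X` REDUCES TO THE LOWER WINDOW** `1 ≤ r`, `2r ≤ i ≤ dim X`,
`i < dim X + r`: a window cell `(i, r)` with `i > n` is `(k + 2j, r' + j)` for `j = i − n`, `k = 2n − i < n`,
`r' = r − j ≥ 1`, and `(k, r')` lies in the lower window (§5 with `forall_generalHodgePropertyFor_iff_window`).
[cite: Voisin2025, §4.3 (first paragraph)] [cite: MurreTorino1994, §5.7–§5.8] -/
theorem forall_generalHodgePropertyFor_iff_lower_window (hX : IsSmoothProjective n X) :
    (∀ i r : ℕ, GeneralHodgePropertyFor n X i r) ↔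
      ∀ i r : ℕ, 1 ≤ r → 2 * r ≤ i → i ≤ n → i < n + r → GeneralHodgePropertyFor n X i r := by
  refine ⟨fun h i r _ _ _ _ ↦ h i r, fun h ↦ (forall_generalHodgePropertyFor_iff_window hX).2 ?_⟩
  intro i r hr h2 hw
  by_cases hi : i ≤ n
  · exact h i r hr h2 hi hw
  · obtain ⟨j, hj⟩ : ∃ j, i = n + j := ⟨i - n, by omega⟩
    obtain ⟨k, hk⟩ : ∃ k, k + j = n := ⟨n - j, by omega⟩
    obtain ⟨r', hr'⟩ : ∃ r', r = r' + j := ⟨r - j, by omega⟩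
    rw [show i = k + 2 * j by omega, hr']
    exact generalHodgePropertyFor_of_add_eq_dim hX hk (h k r' (by omega) (by omega) (by omega) (by omega))

/-- **FOURFOLDS: Grothendieck's amended general Hodge conjecture in all degrees and coniveaux is equivalent to
its three cases `GHC(X, 3, 1)`, `GHC(X, 4, 1)` and `GHC(X, 4, 2)`** (the lower window of a fourfold is
`{(2, 1), (3, 1), (4, 1), (4, 2)}` and `(2, 1)` is Lefschetz `(1,1)`; `GHC(X, 4, 2)` is the Hodge conjecture
for `X` in codimension `2`, `generalHodgePropertyFor_two_mul_self_iff`; `(5, 2)` is the hard-Lefschetz image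
of `(3, 1)`, `(6, 3)` of `(2, 1)`). [cite: Voisin2025, §4.3 (first paragraph) and Prop. 4.8]
[cite: MurreTorino1994, §5.7–§5.8] [cite: VoisinHodgeI2002, §11.3 Thm. 11.30] -/
theorem forall_generalHodgePropertyFor_dim_four_iff (hX : IsSmoothProjective 4 X) :
    (∀ i r : ℕ, GeneralHodgePropertyFor 4 X i r) ↔
      GeneralHodgePropertyFor 4 X 3 1 ∧ GeneralHodgePropertyFor 4 X 4 1 ∧ GeneralHodgePropertyFor 4 X 4 2 := by
  refine ⟨fun h ↦ ⟨h 3 1, h 4 1, h 4 2⟩,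
    fun h ↦ (forall_generalHodgePropertyFor_iff_lower_window hX).2 fun i r hr h2 hi _ ↦ ?_⟩
  obtain ⟨h31, h41, h42⟩ := h
  -- the lower window of a fourfold: (2,1), (3,1), (4,1), (4,2)
  have hcases : (i = 2 ∧ r = 1) ∨ (i = 3 ∧ r = 1) ∨ (i = 4 ∧ r = 1) ∨ (i = 4 ∧ r = 2) := by omega
  rcases hcases with ⟨rfl, rfl⟩ | ⟨rfl, rfl⟩ | ⟨rfl, rfl⟩ | ⟨rfl, rfl⟩
  · exact generalHodgePropertyFor_two_one hX
  · exact h31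
  · exact h41
  · exact h42

end Literature.AlgebraicGeometry.HodgeTheory

end
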